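import Literature.Topology.FourManifolds.LinkTubularUniqueness
import Literature.Topology.FourManifolds.StraightLineIsotopyExtensionSupport
import HarnessLib

/-!
# Uniqueness of tubular neighbourhoods of a link in `S³`: support in a prescribed neighbourhood

Topic `Literature/Topology/FourManifolds`; sibling of `LinkTubularUniqueness.lean`, whose theorem
`Literature.Topology.FourManifolds.Link.exists_diffeomorph_tubularNbhd` (two families of oriented
tubular neighbourhoods `νᵢ`, `ν'ᵢ` of the components of a link agree near the link, up to a
rotation of the fibres, after a diffeomorphism `φ` of `S³` fixing the link pointwise) is sharpened
here by a **support clause**: for every open `W₀ ⊆ S³` containing the link, `φ` may be taken to be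
**the identity off `W₀`**:

* `Literature.Topology.FourManifolds.Link.exists_diffeomorph_tubularNbhd_of_subset`,
* `Literature.Topology.FourManifolds.Link.exists_diffeomorph_tubularNbhd_of_subset'` (rotation
  fields existentially quantified).

This is how the uniqueness of tubular neighbourhoods is printed: Kosinski, *Differential Manifolds*
(1993), Ch. III, Thm. (3.5) — *an isotopy `H_t` of the identity of `N` that keeps `M` fixed* —
obtained from the isotopy extension theorem II.(5.2), whose generating vector field "vanishes
outside of some neighborhood `U` of `B = G(K × [0, 1])`" (proof of II.(5.2), PDF p. 37); Hirsch,
*Differential Topology* (1976), Ch. 4 §5 Thm. 5.3 with Ch. 8 §1 Thm. 1.3 (compact support inside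
the open set carrying the isotopy). In the proof of `LinkTubularUniqueness.lean` the isotopy is the
straight-line isotopy from the identity to `P = ν' ∘ (id × Q) ∘ ν⁻¹` in a stereographic chart
`σ : S³ ∖ {pt} ≅ ℝ³`, stationary on the link; the supported straight-line isotopy extension
`Literature.Topology.FourManifolds.exists_diffeomorph_eqOn_nhdsSet_of_straightLine_of_subset`
(`StraightLineIsotopyExtensionSupport.lean`) makes the chart diffeomorphism the identity off
`σ(W₀ ∖ {pt})`, and the transported diffeomorphism of `S³` is then the identity off `W₀` (the pole
`pt` is fixed because the chart diffeomorphism is the identity off a ball).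

The proof is that of `Link.exists_diffeomorph_tubularNbhd` verbatim apart from this bookkeeping.

## References

* A. Kosinski, *Differential Manifolds*, Academic Press (1993), Ch. II, Thm. (5.2); Ch. III,
  Thm. (3.5) (PDF p. 48). [cite: Kosinski1993, Ch. III Thm (3.5)]
* M. W. Hirsch, *Differential Topology*, GTM 33, Springer (1976), Ch. 4 §5, Thm. 5.3; Ch. 8 §1,
  Thm. 1.3. [cite: Hirsch1976, Ch. 4 §5 Thm. 5.3]

## Design notes

* No local notation and no local instances are declared; `𝕊ⁿ` is written
  `Metric.sphere (0 : EuclideanSpace ℝ (Fin (n + 1))) 1`.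
* Everything in this file is proved; no definition and no named fact is introduced.
-/

noncomputable section

open Set Function Metric Filter
open scoped Manifold ContDiff Topology RealInnerProductSpace

namespace Literature.Topology.FourManifolds

namespace Link

variable {ι : Type*} [Finite ι]

/-- **Uniqueness of tubular neighbourhoods of a link in `S³`, up to rotation of the fibres, by a
diffeomorphism supported in a prescribed neighbourhood of the link.** Let `νᵢ`, `ν'ᵢ` be oriented
tubular neighbourhoods of the components of a link `L` (finitely many components), each family
with pairwise disjoint images, and let `W₀ ⊆ S³` be an open set containing every component. Then
there are a diffeomorphism `φ` of `S³` fixing every component of `L` pointwise **and equal to the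
identity off `W₀`**, and a radius `r > 0`, such that
`φ (νᵢ (x, w)) = ν'ᵢ (x, w₀ uᵢ(x) + w₁ J uᵢ(x))` for `‖w‖ < r`, where `uᵢ = knotFrameUnit νᵢ ν'ᵢ`
is the rotation field of the pair and `J` the quarter turn. Kosinski, *Differential Manifolds*
(1993), Ch. III, Thm. (3.5) (an isotopy of the identity of the ambient manifold keeping the
submanifold fixed; its generator vanishes off a neighbourhood of the track, II.(5.2)); Hirsch
(1976), Ch. 4 §5 Thm. 5.3 with Ch. 8 §1 Thm. 1.3. [cite: Kosinski1993, Ch. III Thm (3.5)] -/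
theorem exists_diffeomorph_tubularNbhd_of_subset (L : Link ι)
    (ν ν' : ∀ i, Knot.TubularNbhd (L.component i))
    (hdisj : Pairwise fun i j ↦ Disjoint (range (ν i)) (range (ν j)))
    (hdisj' : Pairwise fun i j ↦ Disjoint (range (ν' i)) (range (ν' j)))
    {W₀ : Set (Metric.sphere (0 : EuclideanSpace ℝ (Fin 4)) 1)} (hW₀ : IsOpen W₀)
    (hLW₀ : ∀ i, range (L.component i) ⊆ W₀) :
    ∃ φ : (Metric.sphere (0 : EuclideanSpace ℝ (Fin 4)) 1) ≃ₘ⟮𝓡 3, 𝓡 3⟯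
        (Metric.sphere (0 : EuclideanSpace ℝ (Fin 4)) 1),
      (∀ i x, φ (L.component i x) = L.component i x) ∧ (∀ a, a ∉ W₀ → φ a = a) ∧
      ∃ r : ℝ, 0 < r ∧ ∀ i (x : Metric.sphere (0 : EuclideanSpace ℝ (Fin 2)) 1)
        (w : EuclideanSpace ℝ (Fin 2)), ‖w‖ < r →
        φ (ν i (x, w)) = ν' i (x, w 0 • (knotFrameUnit (ν i) (ν' i) x : EuclideanSpace ℝ (Fin 2)) +
          w 1 • quarterTurn (knotFrameUnit (ν i) (ν' i) x : EuclideanSpace ℝ (Fin 2))) := by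
  classical
  -- a stereographic chart missing a point off all the `range (ν' i)`
  obtain ⟨pt, hpt⟩ := exists_not_mem_range L ν' hdisj'
  set σ : OpenPartialHomeomorph (Metric.sphere (0 : EuclideanSpace ℝ (Fin 4)) 1) (EuclideanSpace ℝ
      (Fin 3)) := stereoChart pt with hσ
  have hσsrc : σ.source = {pt}ᶜ := stereoChart_source pt
  have hσtgt : σ.target = univ := stereoChart_target pt
  have hσsm : ContMDiffOn (𝓡 3) (𝓡 3) ∞ σ σ.source := contMDiffOn_stereoChart pt
  have hσsymm : ContMDiff (𝓡 3) (𝓡 3) ∞ σ.symm := contMDiff_stereoChart_symm pt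
  have hν₂src : ∀ i q, ν' i q ∈ σ.source := fun i q => by
    rw [hσsrc]
    exact fun h => hpt i ⟨q, h⟩
  have hν₁src : ∀ i, ∀ q ∈ knotTransitionDom (ν i) (ν' i), ν i q ∈ σ.source := fun i q hq => by
    obtain ⟨q', hq'⟩ := hq
    rw [← hq']
    exact hν₂src i q'
  have hdom_nhds : ∀ i (x : (Metric.sphere (0 : EuclideanSpace ℝ (Fin 2)) 1)),
      knotTransitionDom (ν i) (ν' i) ∈ 𝓝 ((x, (0 : EuclideanSpace ℝ (Fin 2))) : (Metric.sphere (0 :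
          EuclideanSpace ℝ (Fin 2)) 1) × EuclideanSpace ℝ (Fin 2)) := fun i x =>
    (isOpen_knotTransitionDom (ν i) (ν' i)).mem_nhds (mem_knotTransitionDom_zero (ν i) (ν' i) x)
  -- **the prescribed neighbourhood, read in the chart**
  set W' : Set (EuclideanSpace ℝ (Fin 3)) := σ '' (W₀ ∩ σ.source) with hW'
  have hW'open : IsOpen W' :=
    σ.isOpen_image_of_subset_source (hW₀.inter σ.open_source) inter_subset_right
  -- the maps, component by component
  set g : ∀ i, (Metric.sphere (0 : EuclideanSpace ℝ (Fin 2)) 1) → (EuclideanSpace ℝ (Fin 2) ≃ₗᵢ[ℝ]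
      EuclideanSpace ℝ (Fin 2)) := fun i => knotFrame (ν i) (ν' i) with hg
  have hgsmooth : ∀ i, ContMDiff ((𝓡 1).prod 𝓘(ℝ, EuclideanSpace ℝ (Fin 2))) 𝓘(ℝ, EuclideanSpace ℝ
      (Fin 2)) ∞ (fun p : (Metric.sphere (0 : EuclideanSpace ℝ (Fin 2)) 1) × EuclideanSpace ℝ (Fin
      2) => g i p.1 p.2) := fun i =>
    contMDiff_knotFrame (ν i) (ν' i)
  set Qm : ∀ i, (Metric.sphere (0 : EuclideanSpace ℝ (Fin 2)) 1) × EuclideanSpace ℝ (Fin 2) →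
      (Metric.sphere (0 : EuclideanSpace ℝ (Fin 2)) 1) × EuclideanSpace ℝ (Fin 2) := fun i =>
      circleFibrewiseMap (g i) with hQm
  have hQmsm : ∀ i, ContMDiff ((𝓡 1).prod 𝓘(ℝ, EuclideanSpace ℝ (Fin 2))) ((𝓡 1).prod 𝓘(ℝ,
      EuclideanSpace ℝ (Fin 2))) ∞ (Qm i) := fun i => contMDiff_circleFibrewiseMap (hgsmooth i)
  set e₁ : ∀ i, (Metric.sphere (0 : EuclideanSpace ℝ (Fin 2)) 1) × EuclideanSpace ℝ (Fin 2) →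
      EuclideanSpace ℝ (Fin 3) := fun i q => σ (ν i q) with he₁
  set e₂ : ∀ i, (Metric.sphere (0 : EuclideanSpace ℝ (Fin 2)) 1) × EuclideanSpace ℝ (Fin 2) →
      EuclideanSpace ℝ (Fin 3) := fun i q => σ (ν' i q) with he₂
  set Pc : ι → EuclideanSpace ℝ (Fin 3) → EuclideanSpace ℝ (Fin 3) := fun i y => σ (ν' i (Qm i ((ν
      i).toHomeo.symm (σ.symm y)))) with hPc
  set W : ι → Set (EuclideanSpace ℝ (Fin 3)) := fun i => σ '' (ν i '' knotTransitionDom (ν i) (ν'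
      i)) with hW
  set Z : ι → Set (EuclideanSpace ℝ (Fin 3)) := fun i => range fun x : (Metric.sphere (0 :
      EuclideanSpace ℝ (Fin 2)) 1) => e₁ i (x, 0) with hZ
  -- smoothness of `e₁`, `e₂`
  have he₁sm : ∀ i, ∀ q ∈ knotTransitionDom (ν i) (ν' i), ContMDiffAt ((𝓡 1).prod 𝓘(ℝ,
      EuclideanSpace ℝ (Fin 2))) (𝓡 3) ∞ (e₁ i) q :=
    fun i q hq => (hσsm.contMDiffAt (σ.open_source.mem_nhds (hν₁src i q hq))).comp q
      ((ν i).contMDiffAt_coe q)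
  have he₂sm : ∀ i q, ContMDiffAt ((𝓡 1).prod 𝓘(ℝ, EuclideanSpace ℝ (Fin 2))) (𝓡 3) ∞ (e₂ i) q :=
      fun i q =>
    (hσsm.contMDiffAt (σ.open_source.mem_nhds (hν₂src i q))).comp q ((ν' i).contMDiffAt_coe q)
  -- `W i` open, pairwise disjoint; `Z i` compact, inside `W i` and inside `W'`
  have hWopen : ∀ i, IsOpen (W i) := fun i => by
    apply σ.isOpen_image_of_subset_source ((ν i).isOpenMap _ (isOpen_knotTransitionDom (ν i) (ν'
        i)))
    rintro _ ⟨q, hq, rfl⟩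
    exact hν₁src i q hq
  have hWdisj : ∀ {i j} (y : EuclideanSpace ℝ (Fin 3)), y ∈ W i → y ∈ W j → i = j := by
    rintro i j _ ⟨_, ⟨q, hq, rfl⟩, rfl⟩ ⟨_, ⟨q', hq', rfl⟩, hyy⟩
    have h1 : ν j q' = ν i q := σ.injOn (hν₁src j q' hq') (hν₁src i q hq) hyy
    by_contra hij
    exact Set.disjoint_left.1 (hdisj (Ne.symm hij)) (mem_range_self q') (h1 ▸ mem_range_self q)
  have hZcpt : ∀ i, IsCompact (Z i) := fun i => by
    apply isCompact_range
    show Continuous (e₁ i ∘ fun x : (Metric.sphere (0 : EuclideanSpace ℝ (Fin 2)) 1) => ((x, (0 :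
        EuclideanSpace ℝ (Fin 2))) : (Metric.sphere (0 : EuclideanSpace ℝ (Fin 2)) 1) ×
        EuclideanSpace ℝ (Fin 2)))
    have hon : ContinuousOn (e₁ i) (knotTransitionDom (ν i) (ν' i)) := fun q hq =>
      (he₁sm i q hq).continuousAt.continuousWithinAt
    exact hon.comp_continuous (continuous_id.prodMk continuous_const)
      fun x => mem_knotTransitionDom_zero (ν i) (ν' i) x
  have hZW : ∀ i, Z i ⊆ W i := by
    rintro i _ ⟨x, rfl⟩
    exact ⟨ν i (x, 0), ⟨(x, 0), mem_knotTransitionDom_zero (ν i) (ν' i) x, rfl⟩, rfl⟩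
  have hZW'i : ∀ i, Z i ⊆ W' := by
    rintro i _ ⟨x, rfl⟩
    refine ⟨ν i (x, 0), ⟨?_, hν₁src i _ (mem_knotTransitionDom_zero (ν i) (ν' i) x)⟩, rfl⟩
    rw [(ν i).coe_apply_zero]
    exact hLW₀ i ⟨x, rfl⟩
  -- the global map `P`
  set P : EuclideanSpace ℝ (Fin 3) → EuclideanSpace ℝ (Fin 3) := fun y => if h : ∃ i, y ∈ W i then
      Pc (Classical.choose h) y else y with hP
  have hPW : ∀ i, ∀ y ∈ W i, P y = Pc i y := fun i y hy => by
    have h : ∃ j, y ∈ W j := ⟨i, hy⟩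
    have hP' : P y = Pc (Classical.choose h) y := by simp only [hP, dif_pos h]
    rw [hP', hWdisj y (Classical.choose_spec h) hy]
  have hPnot : ∀ y, (∀ i, y ∉ W i) → P y = y := fun y hy => by
    have h : ¬ ∃ j, y ∈ W j := fun ⟨j, hj⟩ => hy j hj
    simp only [hP, dif_neg h]
  -- `Pc i` is smooth on `W i`
  have hPcsm : ∀ i, ContDiffOn ℝ ∞ (Pc i) (W i) := fun i => by
    rw [← contMDiffOn_iff_contDiffOn]
    rintro _ ⟨_, ⟨q, hq, rfl⟩, rfl⟩
    apply ContMDiffAt.contMDiffWithinAt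
    have h1 : ContMDiffAt (𝓡 3) (𝓡 3) ∞ σ.symm (σ (ν i q)) := hσsymm _
    have h2 : ContMDiffAt (𝓡 3) ((𝓡 1).prod 𝓘(ℝ, EuclideanSpace ℝ (Fin 2))) ∞ (ν i).toHomeo.symm
        (σ.symm (σ (ν i q))) := by
      rw [σ.left_inv (hν₁src i q hq)]
      exact (ν i).contMDiffAt_toHomeo_symm ⟨q, rfl⟩
    have h21 : ContMDiffAt (𝓡 3) ((𝓡 1).prod 𝓘(ℝ, EuclideanSpace ℝ (Fin 2))) ∞ ((ν i).toHomeo.symm ∘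
        σ.symm) (σ (ν i q)) := h2.comp _ h1
    have h3 : ContMDiffAt ((𝓡 1).prod 𝓘(ℝ, EuclideanSpace ℝ (Fin 2))) (𝓡 3) ∞ (fun p => σ (ν' i (Qm
        i p)))
        (((ν i).toHomeo.symm ∘ σ.symm) (σ (ν i q))) := (he₂sm i _).comp _ (hQmsm i _)
    exact ContMDiffAt.comp (σ (ν i q)) (g := fun p => σ (ν' i (Qm i p))) h3 h21
  -- `P` is smooth on `W = ⋃ W i`
  have hPsm : ContDiffOn ℝ ∞ P (⋃ i, W i) := by
    intro y hy
    obtain ⟨i, hyi⟩ := mem_iUnion.1 hy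
    have hev : P =ᶠ[𝓝 y] Pc i :=
      Filter.eventuallyEq_of_mem ((hWopen i).mem_nhds hyi) fun y' hy' => hPW i y' hy'
    exact (((hPcsm i).contDiffAt ((hWopen i).mem_nhds hyi)).congr_of_eventuallyEq
        hev).contDiffWithinAt
  -- `P ∘ e₁ = e₂ ∘ Qm` on the domains
  have hPe₁ : ∀ i, ∀ q ∈ knotTransitionDom (ν i) (ν' i), P (e₁ i q) = e₂ i (Qm i q) := fun i q hq =>
      by
    have hyW : e₁ i q ∈ W i := ⟨ν i q, ⟨q, hq, rfl⟩, rfl⟩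
    rw [hPW i _ hyW]
    simp only [hPc, he₁, he₂]
    rw [σ.left_inv (hν₁src i q hq), (ν i).toHomeo_symm_apply]
  have hPZ : ∀ z ∈ ⋃ i, Z i, P z = z := by
    intro z hz
    obtain ⟨i, x, rfl⟩ : ∃ (i : ι) (x : (Metric.sphere (0 : EuclideanSpace ℝ (Fin 2)) 1)), e₁ i (x,
        0) = z := by
      simpa only [mem_iUnion, hZ, mem_range] using hz
    rw [hPe₁ i _ (mem_knotTransitionDom_zero (ν i) (ν' i) x)]
    simp only [he₁, he₂, hQm, circleFibrewiseMap_zero, (ν i).coe_apply_zero, (ν' i).coe_apply_zero]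
  have hWopen' : IsOpen (⋃ i, W i) := isOpen_iUnion hWopen
  have hZcpt' : IsCompact (⋃ i, Z i) := isCompact_iUnion hZcpt
  have hZW' : (⋃ i, Z i) ⊆ ⋃ i, W i := iUnion_mono hZW
  have hZW'all : (⋃ i, Z i) ⊆ W' := iUnion_subset hZW'i
  have hPderiv : ∀ z ∈ ⋃ i, Z i, HasFDerivAt P (fderiv ℝ P z) z := fun z hz =>
    ((hPsm.contDiffAt (hWopen'.mem_nhds (hZW' hz))).differentiableAt (by simp)).hasFDerivAt
  -- **the derivative of the straight-line isotopy is injective along the link**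
  have hinj : ∀ z ∈ ⋃ i, Z i, ∀ t ∈ Icc (0 : ℝ) 1, Injective (slDeriv t (fderiv ℝ P z)) := by
    intro z hz t ht
    obtain ⟨i, x, rfl⟩ : ∃ (i : ι) (x : (Metric.sphere (0 : EuclideanSpace ℝ (Fin 2)) 1)), e₁ i (x,
        0) = z := by
      simpa only [mem_iUnion, hZ, mem_range] using hz
    have hPd : ∀ x' : (Metric.sphere (0 : EuclideanSpace ℝ (Fin 2)) 1), DifferentiableAt ℝ (Pc i)
        (e₁ i (x', 0)) := fun x' =>
      ((hPcsm i).contDiffAt ((hWopen i).mem_nhds (hZW i ⟨x', rfl⟩))).differentiableAt (by simp)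
    have hPce₁ : ∀ q ∈ knotTransitionDom (ν i) (ν' i), Pc i (e₁ i q) = e₂ i (Qm i q) :=
      fun q hq => by rw [← hPW i _ ⟨ν i q, ⟨q, hq, rfl⟩, rfl⟩]; exact hPe₁ i q hq
    have key := injective_slDeriv_component (pt := pt) (ν i) (ν' i) (hν₂src i) hPce₁ hPd x ht
    have hfd : fderiv ℝ P (e₁ i (x, 0)) = fderiv ℝ (Pc i) (e₁ i (x, 0)) := by
      apply Filter.EventuallyEq.fderiv_eq
      exact Filter.eventuallyEq_of_mem ((hWopen i).mem_nhds (hZW i ⟨x, rfl⟩))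
        fun y' hy' => hPW i y' hy'
    rw [hfd]
    exact key
  -- **the supported isotopy extension theorem** in the chart, and transport back to `S³`
  obtain ⟨Φ, hΦP, hΦW', R, hΦR⟩ := exists_diffeomorph_eqOn_nhdsSet_of_straightLine_of_subset
    hZcpt' hWopen' hZW' hPsm hPZ hPderiv hinj hW'open hZW'all
  obtain ⟨H, hH, hHR⟩ := exists_diffeomorph_chartTransport (φ := σ) hσsm hσsymm hσtgt Φ hΦR
  -- the neighbourhood of the link where `Φ = P`
  obtain ⟨U, hUopen, hZU, hUP⟩ : ∃ U : Set (EuclideanSpace ℝ (Fin 3)), IsOpen U ∧ (⋃ i, Z i) ⊆ U ∧ ∀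
      y ∈ U, Φ y = P y := by
    obtain ⟨U, hUo, hZU', hUsub⟩ := mem_nhdsSet_iff_exists.1 hΦP
    exact ⟨U, hUo, hZU', fun y hy => hUsub hy⟩
  have hHν : ∀ i, ∀ q ∈ knotTransitionDom (ν i) (ν' i), e₁ i q ∈ U →
      H (ν i q) = ν' i (Qm i q) := by
    intro i q hq hqU
    have h1 : ν i q = σ.symm (e₁ i q) := (σ.left_inv (hν₁src i q hq)).symm
    rw [h1, hH, hUP _ hqU, hPe₁ i q hq]
    exact σ.left_inv (hν₂src i _)
  refine ⟨H, fun i x => ?_, ?_, ?_⟩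
  · -- `H` fixes the link
    have h := hHν i (x, 0) (mem_knotTransitionDom_zero (ν i) (ν' i) x)
      (hZU (mem_iUnion.2 ⟨i, x, rfl⟩))
    simp only [hQm, circleFibrewiseMap_zero, (ν i).coe_apply_zero, (ν' i).coe_apply_zero] at h
    exact h
  · -- **`H` is the identity off `W₀`**
    intro a ha
    by_cases has : a ∈ σ.source
    · have h1 : a = σ.symm (σ a) := (σ.left_inv has).symm
      have h2 : σ a ∉ W' := by
        rintro ⟨b, ⟨hbW, hbs⟩, hba⟩
        exact ha (σ.injOn hbs has hba ▸ hbW)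
      rw [h1, hH, hΦW' _ h2]
    · apply hHR
      rintro ⟨y, -, hy⟩
      exact has (hy ▸ σ.map_target (by rw [hσtgt]; exact mem_univ _))
  · -- uniform tubes `(Metric.sphere (0 : EuclideanSpace ℝ (Fin 2)) 1) × B_r` inside the good sets (tube lemma, component by component)
    have hrad : ∀ i, ∀ᶠ r in 𝓝[>] (0 : ℝ), ∀ (x : (Metric.sphere (0 : EuclideanSpace ℝ (Fin 2)) 1))
        (w : EuclideanSpace ℝ (Fin 2)), ‖w‖ < r →
        H (ν i (x, w)) = ν' i (Qm i (x, w)) := by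
      intro i
      set V : Set ((Metric.sphere (0 : EuclideanSpace ℝ (Fin 2)) 1) × EuclideanSpace ℝ (Fin 2)) :=
          knotTransitionDom (ν i) (ν' i) ∩ e₁ i ⁻¹' U with hV
      have hVopen : IsOpen V := by
        rw [isOpen_iff_mem_nhds]
        rintro q ⟨hq, hqU⟩
        refine Filter.inter_mem ((isOpen_knotTransitionDom (ν i) (ν' i)).mem_nhds hq) ?_
        exact (he₁sm i q hq).continuousAt.preimage_mem_nhds (hUopen.mem_nhds hqU)
      have hsub : (univ : Set (Metric.sphere (0 : EuclideanSpace ℝ (Fin 2)) 1)) ×ˢ ({0} : Set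
          (EuclideanSpace ℝ (Fin 2))) ⊆ V := by
        rintro ⟨x, w⟩ ⟨-, hw⟩
        rw [mem_singleton_iff] at hw
        subst hw
        exact ⟨mem_knotTransitionDom_zero (ν i) (ν' i) x, hZU (mem_iUnion.2 ⟨i, x, rfl⟩)⟩
      obtain ⟨u₀, v₀, -, hv₀, hu₀, h0v₀, huv⟩ :=
        generalized_tube_lemma isCompact_univ isCompact_singleton hVopen hsub
      obtain ⟨r₀, hr₀, hrv⟩ := Metric.isOpen_iff.1 hv₀ 0 (h0v₀ rfl)
      filter_upwards [Ioo_mem_nhdsGT hr₀] with r hr x w hw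
      have hq : ((x, w) : (Metric.sphere (0 : EuclideanSpace ℝ (Fin 2)) 1) × EuclideanSpace ℝ (Fin
          2)) ∈ V :=
        huv ⟨hu₀ (mem_univ x), hrv (mem_ball_zero_iff.2 (hw.trans hr.2))⟩
      exact hHν i (x, w) hq.1 hq.2
    have hall : ∀ᶠ r in 𝓝[>] (0 : ℝ), 0 < r ∧ ∀ i (x : (Metric.sphere (0 : EuclideanSpace ℝ (Fin 2))
        1)) (w : EuclideanSpace ℝ (Fin 2)), ‖w‖ < r →
        H (ν i (x, w)) = ν' i (Qm i (x, w)) :=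
      (eventually_mem_nhdsWithin).and (Filter.eventually_all.2 hrad)
    obtain ⟨r, hr, hrH⟩ := hall.exists
    refine ⟨r, hr, fun i x w hw => ?_⟩
    rw [hrH i x w hw]
    simp only [hQm, hg, circleFibrewiseMap_apply, knotFrame_apply, coe_knotFrameUnit]

/-- **Uniqueness of tubular neighbourhoods of a link in `S³`, up to rotation of the fibres, by a
diffeomorphism supported in a prescribed neighbourhood of the link** (rotation-field form): as
`exists_diffeomorph_tubularNbhd_of_subset`, with the rotation fields `uᵢ : S¹ → S¹` existentially
quantified together with their smoothness. [cite: Kosinski1993, Ch. III Thm (3.5)] -/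
theorem exists_diffeomorph_tubularNbhd_of_subset' (L : Link ι)
    (ν ν' : ∀ i, Knot.TubularNbhd (L.component i))
    (hdisj : Pairwise fun i j ↦ Disjoint (range (ν i)) (range (ν j)))
    (hdisj' : Pairwise fun i j ↦ Disjoint (range (ν' i)) (range (ν' j)))
    {W₀ : Set (Metric.sphere (0 : EuclideanSpace ℝ (Fin 4)) 1)} (hW₀ : IsOpen W₀)
    (hLW₀ : ∀ i, range (L.component i) ⊆ W₀) :
    ∃ φ : (Metric.sphere (0 : EuclideanSpace ℝ (Fin 4)) 1) ≃ₘ⟮𝓡 3, 𝓡 3⟯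
        (Metric.sphere (0 : EuclideanSpace ℝ (Fin 4)) 1),
      (∀ i x, φ (L.component i x) = L.component i x) ∧ (∀ a, a ∉ W₀ → φ a = a) ∧
      ∃ u : ι → Metric.sphere (0 : EuclideanSpace ℝ (Fin 2)) 1 →
          Metric.sphere (0 : EuclideanSpace ℝ (Fin 2)) 1,
        (∀ i, ContMDiff (𝓡 1) (𝓡 1) ∞ (u i)) ∧
      ∃ r : ℝ, 0 < r ∧ ∀ i (x : Metric.sphere (0 : EuclideanSpace ℝ (Fin 2)) 1)
        (w : EuclideanSpace ℝ (Fin 2)), ‖w‖ < r →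
        φ (ν i (x, w)) = ν' i (x, w 0 • (u i x : EuclideanSpace ℝ (Fin 2)) +
          w 1 • quarterTurn (u i x : EuclideanSpace ℝ (Fin 2))) := by
  obtain ⟨φ, hφ, hφW, r, hr, hφν⟩ := exists_diffeomorph_tubularNbhd_of_subset L ν ν' hdisj hdisj'
    hW₀ hLW₀
  exact ⟨φ, hφ, hφW, fun i => knotFrameUnit (ν i) (ν' i),
    fun i => contMDiff_knotFrameUnit (ν i) (ν' i), r, hr, hφν⟩

end Link

end Literature.Topology.FourManifolds
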